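import Summits.PneNP.PneNP.Theorems.SzkEntropyPeaThreeNotInPLatticeDefs
import Literature.Computability.Complexity.CodeFPArith
import Literature.Computability.Complexity.CodeFPBudgets
import Literature.Computability.Complexity.CodeFPLists
import Literature.Computability.Complexity.CodeFPListKit
import Literature.Computability.Complexity.CodeFPStrings
import Literature.Computability.QuantumComplexity.HidingProgramMachine
import HarnessLib

/-!
# Route SzkEntropy, crux `PeaThreeNotInP` (stmt-PneNP-10776), line `SketchIdeator3`, socket client
# `lattice-cube-smoothing`: the instance map `GapCVP_n → PEDBPGap 1 10` is typed polynomial time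
# (stub `stub_instanceFP`)

The guarded raw instance map `latRedG` of `SzkEntropyPeaThreeNotInPLatticeDefs.lean` is computed on
codes (`CodeFP`, `Literature/Computability/Complexity/CodeFP*.lean`) from the `GapCodes.cvpTupE` code
of the raw data `c = ((n, (flat, tl)), (num, den))` to the tuple code of `PEDBP` instances, given a
`CodeFP` program `hA` for the carry automaton `(cs, 1ʲ) ↦ affineBitRaw cs j` (stub `stub_affineFP`).

The machine works throughout with the NORMALISED tuple `ĉ = ((|tl|, (flat, tl)), (num, den))` (the
announced dimension replaced by the length of the target list): it agrees with `c` under the guard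
`|flat| = n², |tl| = n` of `latRedG`, and its dimension `ĉ.n = |tl|` is available in UNARY
(`CodeFP.ulength`), so that every loop bound of the reduction (`ℓ`, `m`, `W`, `n ℓ + n m`, `n W`) is
an honest unary budget obtained by unary arithmetic, and `c ↦ latRedTup ĉ` is polynomial time on
ALL tuples.  Layers (one `CodeFP` lemma each, functional programs on codes, no machine written):

* readers of the code and the parameters `a`, `S₀`, `m`, `M`, `cK`, `K`, `ℓ`, `W`, `nzE`, `N` of `ĉ`
  in binary, the budgets `m`, `ℓ`, `W`, `nzE`, `n W` in unary (`ifp_h*`, `ifp_h*U`);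
* entries `B i' i`, `t i` by indexing (`rawGetOr`), the coefficient lists `coefZE`/`csP`/`csQ`/`csB`
  (`map` with context over unary ranges, powers of `2` by capped unary exponents);
* the programs `progsP`, `progsQ` (`map` of `hA` over the unary range `[0, n W)`, the bit index
  `r mod W` converted to unary against the budget `W`);
* the one-dimensional test `oneDimFar`, the case split of `latRedTup`, and the guard (`stub_instanceFP`).

References: S. Arora, B. Barak, *Computational Complexity: A Modern Approach*, CUP 2009, §1.3
(closure of polynomial time under composition and polynomially bounded loops); Z. Dvir,
D. Gutfreund, G. N. Rothblum, S. Vadhan, *On approximating the entropy of polynomial mappings*,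
ECCC TR10-160 (2010), §4.2, §4.4; D. Micciancio, S. Goldwasser, *Complexity of Lattice Problems*,
Kluwer 2002, Ch. 1 §1.2 (instance format).
-/

namespace Summit.PneNP.PneNP.Cruxes.PeaThreeNotInP.LatticeLine

set_option linter.dupNamespace false -- `Summit.PneNP.PneNP.…`: summit = sub-problem name (D-0017)

open Literature.Computability.Complexity Literature.Algebra.EuclideanLattices
open CodeFP (natE unE intE smE pairE rawE listE bitE unitE strE)
open Summit.PneNP.PneNP.Cruxes.PeaThreeNotInP.SocketBP (affineBitRaw)
open Literature.Computability.QuantumComplexity (unMul_codeFP natSizeU_codeFP)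

/-! ### Readers of the instance code

Generic leaves reused from the toolkit: unary products `unMul_codeFP` and the size of a numeral in
unary `natSizeU_codeFP` (`QuantumComplexity/HidingProgramMachine.lean`), sums `CodeFP.natSum`. -/

/-- `Σ |z|` over a raw list of integers, in binary. [folklore] -/
theorem ifp_sumNatAbs : CodeFP (rawE intE) natE (fun l : List ℤ => (l.map Int.natAbs).sum) :=
  CodeFP.natSum.comp (CodeFP.map₀ CodeFP.intNatAbs)

/-- The row-major entry list `flat` off the code (headed sign–magnitude list to raw difference-pair
list). [cite: MicciancioGoldwasser2002, Ch. 1 §1.2] -/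
theorem ifp_flat : CodeFP GapCodes.cvpTupE (rawE intE) CVPTup.flat :=
  ((CodeFP.map₀ CodeFP.intOfSM).comp ((CodeFP.rawOfList smE).comp (CodeFP.fst _ _).snd'.fst')).congr
    fun _ => List.map_id _

/-- The target entry list `tl` off the code. [cite: MicciancioGoldwasser2002, Ch. 1 §1.2] -/
theorem ifp_tl : CodeFP GapCodes.cvpTupE (rawE intE) CVPTup.tl :=
  ((CodeFP.map₀ CodeFP.intOfSM).comp ((CodeFP.rawOfList smE).comp (CodeFP.fst _ _).snd'.snd')).congr
    fun _ => List.map_id _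

/-- The numerator `num` off the code. [folklore] -/
theorem ifp_num : CodeFP GapCodes.cvpTupE intE CVPTup.num :=
  (CodeFP.intOfSM.comp (CodeFP.snd _ _).fst').congr fun _ => rfl

/-- The denominator `den` off the code. [folklore] -/
theorem ifp_den : CodeFP GapCodes.cvpTupE natE CVPTup.den := ((CodeFP.snd _ _).snd').congr fun _ => rfl

/-- The announced dimension `n` (binary) off the code. [folklore] -/
theorem ifp_n : CodeFP GapCodes.cvpTupE natE CVPTup.n := ((CodeFP.fst _ _).fst').congr fun _ => rfl

/-! ### The normalised tuple `ĉ = ((|tl|, (flat, tl)), (num, den))`: dimension in unary and binary -/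

/-- The dimension of `ĉ` in UNARY: the length of the target list. [folklore] -/
theorem ifp_hnU : CodeFP GapCodes.cvpTupE unE (fun c : CVPTup => CVPTup.n (((CVPTup.tl c).length, c.1.2), c.2)) :=
  ((CodeFP.ulength intE).comp ifp_tl).congr fun _ => rfl

/-- The dimension of `ĉ` in binary. [folklore] -/
theorem ifp_hn : CodeFP GapCodes.cvpTupE natE (fun c : CVPTup => CVPTup.n (((CVPTup.tl c).length, c.1.2), c.2)) :=
  ((CodeFP.natLength intE).comp ifp_tl).congr fun _ => rfl

/-- `flat` of `ĉ`. [folklore] -/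
theorem ifp_hflat : CodeFP GapCodes.cvpTupE (rawE intE) (fun c : CVPTup => CVPTup.flat (((CVPTup.tl c).length, c.1.2), c.2)) :=
  ifp_flat.congr fun _ => rfl

/-- `tl` of `ĉ`. [folklore] -/
theorem ifp_htl : CodeFP GapCodes.cvpTupE (rawE intE) (fun c : CVPTup => CVPTup.tl (((CVPTup.tl c).length, c.1.2), c.2)) :=
  ifp_tl.congr fun _ => rfl

/-- `num` of `ĉ`. [folklore] -/
theorem ifp_hnum : CodeFP GapCodes.cvpTupE intE (fun c : CVPTup => CVPTup.num (((CVPTup.tl c).length, c.1.2), c.2)) :=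
  ifp_num.congr fun _ => rfl

/-- `den` of `ĉ`. [folklore] -/
theorem ifp_hden : CodeFP GapCodes.cvpTupE natE (fun c : CVPTup => CVPTup.den (((CVPTup.tl c).length, c.1.2), c.2)) :=
  ifp_den.congr fun _ => rfl

/-! ### The parameters of `ĉ` -/

/-- `a = num⁺` of `ĉ`. [folklore] -/
theorem ifp_ha : CodeFP GapCodes.cvpTupE natE (fun c : CVPTup => CVPTup.a (((CVPTup.tl c).length, c.1.2), c.2)) :=
  (CodeFP.intToNat.comp ifp_hnum).congr fun _ => rfl

/-- `S₀ = Σ|B| + Σ|t| + a + 1` of `ĉ`. [folklore] -/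
theorem ifp_hS0 : CodeFP GapCodes.cvpTupE natE (fun c : CVPTup => CVPTup.S₀ (((CVPTup.tl c).length, c.1.2), c.2)) :=
  (CodeFP.natAdd.comp ((CodeFP.natAdd.comp ((CodeFP.natAdd.comp ((ifp_sumNatAbs.comp ifp_hflat).pair
    (ifp_sumNatAbs.comp ifp_htl))).pair ifp_ha)).pair (CodeFP.const _ 1))).congr fun _ => rfl

/-- `m = size (64 n a)` of `ĉ`, in unary. [folklore] -/
theorem ifp_hmU : CodeFP GapCodes.cvpTupE unE (fun c : CVPTup => CVPTup.m (((CVPTup.tl c).length, c.1.2), c.2)) :=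
  (natSizeU_codeFP.comp (CodeFP.natMul.comp ((CodeFP.natMul.comp ((CodeFP.const _ 64).pair ifp_hn)).pair ifp_ha))).congr
    fun _ => rfl

/-- `m` of `ĉ`, in binary. [folklore] -/
theorem ifp_hm : CodeFP GapCodes.cvpTupE natE (fun c : CVPTup => CVPTup.m (((CVPTup.tl c).length, c.1.2), c.2)) :=
  (CodeFP.natOfUn.comp ifp_hmU).congr fun _ => rfl

/-- `M = 2^m` of `ĉ` (power by the unary exponent). [folklore] -/
theorem ifp_hM : CodeFP GapCodes.cvpTupE natE (fun c : CVPTup => CVPTup.M (((CVPTup.tl c).length, c.1.2), c.2)) :=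
  (CodeFP.natPow.comp ((CodeFP.const _ 2).pair ifp_hmU)).congr fun _ => rfl

/-- `cK = ⌈(M−1)² den² / (n a²)⌉` of `ĉ` (squares as powers by the unary constant `2`). [folklore] -/
theorem ifp_hcK : CodeFP GapCodes.cvpTupE natE (fun c : CVPTup => CVPTup.cK (((CVPTup.tl c).length, c.1.2), c.2)) := by
  have h2 : CodeFP GapCodes.cvpTupE unE (fun _ => 2) := CodeFP.const _ 2
  have hna2 : CodeFP GapCodes.cvpTupE natE (fun c : CVPTup => CVPTup.n (((CVPTup.tl c).length, c.1.2), c.2) *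
      CVPTup.a (((CVPTup.tl c).length, c.1.2), c.2) ^ 2) :=
    CodeFP.natMul.comp (ifp_hn.pair (CodeFP.natPow.comp (ifp_ha.pair h2)))
  have hnumer : CodeFP GapCodes.cvpTupE natE (fun c : CVPTup =>
      (CVPTup.M (((CVPTup.tl c).length, c.1.2), c.2) - 1) ^ 2 * CVPTup.den (((CVPTup.tl c).length, c.1.2), c.2) ^ 2 +
        CVPTup.n (((CVPTup.tl c).length, c.1.2), c.2) * CVPTup.a (((CVPTup.tl c).length, c.1.2), c.2) ^ 2 - 1) :=
    CodeFP.natSub.comp ((CodeFP.natAdd.comp ((CodeFP.natMul.comp ((CodeFP.natPow.comp ((CodeFP.natSub.comp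
      (ifp_hM.pair (CodeFP.const _ 1))).pair h2)).pair (CodeFP.natPow.comp (ifp_hden.pair h2)))).pair hna2)).pair
      (CodeFP.const _ 1))
  exact (CodeFP.natDiv.comp (hnumer.pair hna2)).congr fun _ => rfl

/-- `K = Nat.sqrt (cK − 1) + 1` of `ĉ`. [folklore] -/
theorem ifp_hK : CodeFP GapCodes.cvpTupE natE (fun c : CVPTup => CVPTup.K (((CVPTup.tl c).length, c.1.2), c.2)) :=
  (CodeFP.natAdd.comp ((CodeFP.natSqrt.comp (CodeFP.natSub.comp (ifp_hcK.pair (CodeFP.const _ 1)))).pair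
    (CodeFP.const _ 1))).congr fun _ => rfl

/-- `ℓ = 5 + (n + 1) size (n S₀ + 1)` of `ĉ`, in UNARY (unary `n`, unary size). [folklore] -/
theorem ifp_hellU : CodeFP GapCodes.cvpTupE unE (fun c : CVPTup => CVPTup.ℓ (((CVPTup.tl c).length, c.1.2), c.2)) :=
  (CodeFP.unAdd.comp ((CodeFP.const _ 5).pair (unMul_codeFP.comp ((CodeFP.unSucc.comp ifp_hnU).pair
    (natSizeU_codeFP.comp (CodeFP.natAdd.comp ((CodeFP.natMul.comp (ifp_hn.pair ifp_hS0)).pair (CodeFP.const _ 1)))))))).congr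
    fun _ => rfl

/-- `ℓ` of `ĉ`, in binary. [folklore] -/
theorem ifp_hell : CodeFP GapCodes.cvpTupE natE (fun c : CVPTup => CVPTup.ℓ (((CVPTup.tl c).length, c.1.2), c.2)) :=
  (CodeFP.natOfUn.comp ifp_hellU).congr fun _ => rfl

/-- `W = ℓ + m + size (K S₀) + 1` of `ĉ`, in UNARY. [folklore] -/
theorem ifp_hWU : CodeFP GapCodes.cvpTupE unE (fun c : CVPTup => CVPTup.W (((CVPTup.tl c).length, c.1.2), c.2)) :=
  (CodeFP.unAdd.comp ((CodeFP.unAdd.comp ((CodeFP.unAdd.comp (ifp_hellU.pair ifp_hmU)).pair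
    (natSizeU_codeFP.comp (CodeFP.natMul.comp (ifp_hK.pair ifp_hS0))))).pair (CodeFP.const _ 1))).congr fun _ => rfl

/-- `W` of `ĉ`, in binary. [folklore] -/
theorem ifp_hW : CodeFP GapCodes.cvpTupE natE (fun c : CVPTup => CVPTup.W (((CVPTup.tl c).length, c.1.2), c.2)) :=
  (CodeFP.natOfUn.comp ifp_hWU).congr fun _ => rfl

/-- `nzE = n ℓ + n m` of `ĉ`, in UNARY. [folklore] -/
theorem ifp_hnzEU : CodeFP GapCodes.cvpTupE unE (fun c : CVPTup => CVPTup.nzE (((CVPTup.tl c).length, c.1.2), c.2)) :=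
  (CodeFP.unAdd.comp ((unMul_codeFP.comp (ifp_hnU.pair ifp_hellU)).pair (unMul_codeFP.comp (ifp_hnU.pair ifp_hmU)))).congr
    fun _ => rfl

/-- `nzE` of `ĉ`, in binary. [folklore] -/
theorem ifp_hnzE : CodeFP GapCodes.cvpTupE natE (fun c : CVPTup => CVPTup.nzE (((CVPTup.tl c).length, c.1.2), c.2)) :=
  (CodeFP.natOfUn.comp ifp_hnzEU).congr fun _ => rfl

/-- `N = nzE + 1` of `ĉ`, in binary. [folklore] -/
theorem ifp_hN : CodeFP GapCodes.cvpTupE natE (fun c : CVPTup => CVPTup.N (((CVPTup.tl c).length, c.1.2), c.2)) :=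
  (CodeFP.natAdd.comp (ifp_hnzE.pair (CodeFP.const _ 1))).congr fun _ => rfl

/-- The number of programs `n W` of `ĉ`, in UNARY. [folklore] -/
theorem ifp_hnWU : CodeFP GapCodes.cvpTupE unE (fun c : CVPTup => CVPTup.n (((CVPTup.tl c).length, c.1.2), c.2) *
    CVPTup.W (((CVPTup.tl c).length, c.1.2), c.2)) :=
  unMul_codeFP.comp (ifp_hnU.pair ifp_hWU)

/-! ### Entries, coefficient lists -/

/-- The basis entry `B i' i` of `ĉ` (argument `(c, i', i)`), read at the binary index `i' n + i`.
[folklore] -/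
theorem ifp_hentry : CodeFP (pairE GapCodes.cvpTupE (pairE natE natE)) intE
    (fun p : CVPTup × (ℕ × ℕ) => CVPTup.entry (((CVPTup.tl p.1).length, p.1.1.2), p.1.2) p.2.1 p.2.2) :=
  ((CodeFP.rawGetOr intE).comp ((ifp_hflat.comp (CodeFP.fst _ _)).pair ((CodeFP.natAdd.comp ((CodeFP.natMul.comp
    ((CodeFP.snd _ _).fst'.pair (ifp_hn.comp (CodeFP.fst _ _)))).pair (CodeFP.snd _ _).snd')).pair
    (CodeFP.const _ (0 : ℤ))))).congr fun _ => rfl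

/-- The target entry `t i` of `ĉ` (argument `(c, i)`). [folklore] -/
theorem ifp_htgt : CodeFP (pairE GapCodes.cvpTupE natE) intE
    (fun p : CVPTup × ℕ => CVPTup.tgt (((CVPTup.tl p.1).length, p.1.1.2), p.1.2) p.2) :=
  ((CodeFP.rawGetOr intE).comp ((ifp_htl.comp (CodeFP.fst _ _)).pair ((CodeFP.snd _ _).pair
    (CodeFP.const _ (0 : ℤ))))).congr fun _ => rfl

/-- `(1ᵇ, e) ↦ 2 ^ min e b` as an integer (power by the capped unary exponent). [folklore] -/
theorem ifp_pow2 : CodeFP (pairE unE natE) intE (fun p : ℕ × ℕ => (2 : ℤ) ^ min p.2 p.1) :=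
  (CodeFP.intPow.comp ((CodeFP.const _ (2 : ℤ)).pair CodeFP.unOfNatMin)).congr fun _ => rfl

/-- **The coefficient list `[coefZE i k | k < n ℓ + n m]` of `ĉ`** (argument `(c, i)`): a `map` with
context over the unary range, the powers `2^(k mod ℓ)`, `2^((k − nℓ) mod m)` by exponents capped at
the unary budget `n ℓ + n m > k`. [cite: AroraBarak2009, §1.3] -/
theorem ifp_hcoefs : CodeFP (pairE GapCodes.cvpTupE natE) (rawE intE)
    (fun p : CVPTup × ℕ => (List.range (CVPTup.nzE (((CVPTup.tl p.1).length, p.1.1.2), p.1.2))).map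
      (CVPTup.coefZE (((CVPTup.tl p.1).length, p.1.1.2), p.1.2) p.2)) := by
  let cE := pairE (pairE GapCodes.cvpTupE natE) natE
  have hc : CodeFP cE GapCodes.cvpTupE (fun t => t.1.1) := (CodeFP.fst _ _).fst'
  have hi : CodeFP cE natE (fun t => t.1.2) := (CodeFP.fst _ _).snd'
  have hk : CodeFP cE natE (fun t => t.2) := CodeFP.snd _ _
  have hn := ifp_hn.comp hc
  have hl := ifp_hell.comp hc
  have hm := ifp_hm.comp hc
  have hB := ifp_hnzEU.comp hc
  have hK := CodeFP.intOfNat.comp (ifp_hK.comp hc)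
  have hnl := CodeFP.natMul.comp (hn.pair hl)
  -- the `z`-block: `K · B (k / ℓ) i · 2^(k mod ℓ)`
  have hent := ifp_hentry.comp (hc.pair ((CodeFP.natDiv.comp (hk.pair hl)).pair hi))
  have hp1 := ifp_pow2.comp (hB.pair (CodeFP.natMod.comp (hk.pair hl)))
  have hbr1 := CodeFP.intMul.comp ((CodeFP.intMul.comp (hK.pair hent)).pair hp1)
  -- the `e`-block: `2^((k − nℓ) mod m)` on the bits of `e_i`
  have hk' := CodeFP.natSub.comp (hk.pair hnl)
  have hp2 := ifp_pow2.comp (hB.pair (CodeFP.natMod.comp (hk'.pair hm)))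
  have hbr2 := (CodeFP.natEq.comp ((CodeFP.natDiv.comp (hk'.pair hm)).pair hi)).ite hp2 (CodeFP.const _ (0 : ℤ))
  have hitem := (CodeFP.natLt.comp (hk.pair hnl)).ite hbr1 hbr2
  have hmap := (CodeFP.map hitem).comp ((CodeFP.id _).pair (CodeFP.urange.comp (ifp_hnzEU.comp (CodeFP.fst _ _))))
  refine hmap.congr fun p => List.map_congr_left fun k hk => ?_
  rw [List.mem_range] at hk
  simp only [id, decide_eq_true_eq, CVPTup.coefZE]
  rw [min_eq_left ((Nat.mod_le _ _).trans hk.le),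
    min_eq_left ((Nat.mod_le _ _).trans ((Nat.sub_le _ _).trans hk.le))]

/-- The coefficient list `csP i` of `ĉ` (argument `(c, i)`). [folklore] -/
theorem ifp_hcsP : CodeFP (pairE GapCodes.cvpTupE natE) (rawE intE)
    (fun p : CVPTup × ℕ => CVPTup.csP (((CVPTup.tl p.1).length, p.1.1.2), p.1.2) p.2) :=
  ((CodeFP.rawCons intE).comp ((CodeFP.intMul.comp ((CodeFP.intOfNat.comp (ifp_hK.comp (CodeFP.fst _ _))).pair
    ifp_htgt)).pair ifp_hcoefs)).congr fun _ => rfl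

/-- The coefficient list `csQ i` of `ĉ` (argument `(c, i)`). [folklore] -/
theorem ifp_hcsQ : CodeFP (pairE GapCodes.cvpTupE natE) (rawE intE)
    (fun p : CVPTup × ℕ => CVPTup.csQ (((CVPTup.tl p.1).length, p.1.1.2), p.1.2) p.2) :=
  ((CodeFP.rawCons intE).comp ((CodeFP.const _ (0 : ℤ)).pair ifp_hcoefs)).congr fun _ => rfl

/-- The coefficient list `csB` of `ĉ`. [folklore] -/
theorem ifp_hcsB : CodeFP GapCodes.cvpTupE (rawE intE) (fun c : CVPTup => CVPTup.csB (((CVPTup.tl c).length, c.1.2), c.2)) :=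
  ((CodeFP.rawCons intE).comp ((CodeFP.const _ (1 : ℤ)).pair ((CodeFP.replicateOf intE).comp
    ((CodeFP.const _ (0 : ℤ)).pair ifp_hnzEU)))).congr fun _ => rfl

/-! ### The programs -/

/-- **The programs `progsP` of `ĉ`**: a `map` with context over the unary range `[0, n W)`, program
`r` being the carry automaton of bit `r mod W` (unary, capped at the budget `W`) of the form
`csP (r / W)`. [cite: DvirGutfreundRothblumVadhan2010, §4.2; AroraBarak2009, §1.3] -/
theorem ifp_hprogsP (hA : CodeFP (pairE (rawE intE) unE) (rawE (pairE natE (pairE natE (pairE natE natE)))) (fun p => affineBitRaw p.1 p.2)) :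
    CodeFP GapCodes.cvpTupE (rawE (rawE (pairE natE (pairE natE (pairE natE natE)))))
      (fun c : CVPTup => CVPTup.progsP (((CVPTup.tl c).length, c.1.2), c.2)) := by
  let cE := pairE GapCodes.cvpTupE natE
  have hc : CodeFP cE GapCodes.cvpTupE (fun t => t.1) := CodeFP.fst _ _
  have hr : CodeFP cE natE (fun t => t.2) := CodeFP.snd _ _
  have hW := ifp_hW.comp hc
  have hcs := ifp_hcsP.comp (hc.pair (CodeFP.natDiv.comp (hr.pair hW)))
  have hj := CodeFP.unOfNatMin.comp ((ifp_hWU.comp hc).pair (CodeFP.natMod.comp (hr.pair hW)))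
  have hmap := (CodeFP.map (hA.comp (hcs.pair hj))).comp ((CodeFP.id _).pair (CodeFP.urange.comp ifp_hnWU))
  refine hmap.congr fun c => List.map_congr_left fun r _ => ?_
  have hW0 : 0 < CVPTup.W (((CVPTup.tl c).length, c.1.2), c.2) := Nat.succ_pos _
  simp only [id]
  rw [min_eq_left (Nat.mod_lt _ hW0).le]

/-- **The programs `progsQ` of `ĉ`**: the `n W` bit programs of the forms `csQ (r / W)`, then the
program of the bit `b` (form `csB`, bit `0`). [cite: DvirGutfreundRothblumVadhan2010, §4.2; AroraBarak2009, §1.3] -/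
theorem ifp_hprogsQ (hA : CodeFP (pairE (rawE intE) unE) (rawE (pairE natE (pairE natE (pairE natE natE)))) (fun p => affineBitRaw p.1 p.2)) :
    CodeFP GapCodes.cvpTupE (rawE (rawE (pairE natE (pairE natE (pairE natE natE)))))
      (fun c : CVPTup => CVPTup.progsQ (((CVPTup.tl c).length, c.1.2), c.2)) := by
  let cE := pairE GapCodes.cvpTupE natE
  have hc : CodeFP cE GapCodes.cvpTupE (fun t => t.1) := CodeFP.fst _ _
  have hr : CodeFP cE natE (fun t => t.2) := CodeFP.snd _ _
  have hW := ifp_hW.comp hc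
  have hcs := ifp_hcsQ.comp (hc.pair (CodeFP.natDiv.comp (hr.pair hW)))
  have hj := CodeFP.unOfNatMin.comp ((ifp_hWU.comp hc).pair (CodeFP.natMod.comp (hr.pair hW)))
  have hmap := (CodeFP.map (hA.comp (hcs.pair hj))).comp ((CodeFP.id _).pair (CodeFP.urange.comp ifp_hnWU))
  have hlast := (CodeFP.rawSingleton _).comp (hA.comp (ifp_hcsB.pair (CodeFP.const _ (0 : ℕ))))
  refine ((CodeFP.rawAppend _).comp (hmap.pair hlast)).congr fun c => ?_
  show _ ++ _ = _ ++ _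
  congr 1
  refine List.map_congr_left fun r _ => ?_
  have hW0 : 0 < CVPTup.W (((CVPTup.tl c).length, c.1.2), c.2) := Nat.succ_pos _
  simp only [id]
  rw [min_eq_left (Nat.mod_lt _ hW0).le]

/-! ### The one-dimensional test, the generic image, the case split, the guard -/

/-- The one-dimensional far test `oneDimFar g t num den` on codes (argument `(g, t, num, den)`):
`t mod |g| = t − |g| (t / |g|)`, the minimum by a comparison. [folklore] -/
theorem ifp_oneDimFar : CodeFP (pairE intE (pairE intE (pairE intE natE))) bitE
    (fun p : ℤ × ℤ × ℤ × ℕ => oneDimFar p.1 p.2.1 p.2.2.1 p.2.2.2) := by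
  let cE := pairE intE (pairE intE (pairE intE natE))
  have hg : CodeFP cE intE (fun p => p.1) := CodeFP.fst _ _
  have ht : CodeFP cE intE (fun p => p.2.1) := (CodeFP.snd _ _).fst'
  have hnum : CodeFP cE intE (fun p => p.2.2.1) := (CodeFP.snd _ _).snd'.fst'
  have hden : CodeFP cE intE (fun p => (p.2.2.2 : ℤ)) := (CodeFP.intOfNat.comp (CodeFP.snd _ _).snd'.snd' :)
  have hag : CodeFP cE intE (fun p => |p.1|) := (CodeFP.intAbs.comp hg :)
  have htm : CodeFP cE intE (fun p => p.2.1 % |p.1|) :=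
    (CodeFP.intSub.comp (ht.pair (CodeFP.intMul.comp (hag.pair (CodeFP.intEDiv.comp (ht.pair hag)))))).congr
      fun p => (Int.emod_def _ _).symm
  have hdf : CodeFP cE intE (fun p => |p.1| - p.2.1 % |p.1|) := (CodeFP.intSub.comp (hag.pair htm) :)
  have hmin : CodeFP cE intE (fun p => min (p.2.1 % |p.1|) (|p.1| - p.2.1 % |p.1|)) :=
    ((CodeFP.intLe.comp (htm.pair hdf)).ite htm hdf).congr fun p => by
      simp only [decide_eq_true_eq]; exact (min_def _ _).symm
  exact (CodeFP.intLt.comp (hnum.pair (CodeFP.intMul.comp (hden.pair hmin)))).congr fun _ => rfl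

/-- Raw programs lists to the headed format of `PEDBPInst` codes. [folklore] -/
theorem ifp_headed : CodeFP (rawE (rawE (pairE natE (pairE natE (pairE natE natE)))))
    (listE (listE (pairE natE (pairE natE (pairE natE natE))))) id :=
  ((CodeFP.listOfRaw (listE _)).comp (CodeFP.map₀ (CodeFP.listOfRaw _))).congr fun _ => by simp

/-- The generic image `((N, progsP), (N, progsQ))` of `ĉ`. [cite: DvirGutfreundRothblumVadhan2010, Thm 4.6] -/
theorem ifp_hgeneric (hA : CodeFP (pairE (rawE intE) unE) (rawE (pairE natE (pairE natE (pairE natE natE)))) (fun p => affineBitRaw p.1 p.2)) :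
    CodeFP GapCodes.cvpTupE (pairE (pairE natE (listE (listE (pairE natE (pairE natE (pairE natE natE))))))
      (pairE natE (listE (listE (pairE natE (pairE natE (pairE natE natE)))))))
      (fun c : CVPTup => CVPTup.generic (((CVPTup.tl c).length, c.1.2), c.2)) :=
  ((ifp_hN.pair (ifp_headed.comp (ifp_hprogsP hA))).pair (ifp_hN.pair (ifp_headed.comp (ifp_hprogsQ hA)))).congr
    fun _ => rfl

/-- **The instance map on the normalised tuple, `c ↦ latRedTup ĉ`, is typed polynomial time** (on
ALL tuples: `ĉ.n = |tl| ≤ |code|`). [cite: DvirGutfreundRothblumVadhan2010, §4.4; AroraBarak2009, §1.3] -/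
theorem ifp_latRedTupNorm (hA : CodeFP (pairE (rawE intE) unE) (rawE (pairE natE (pairE natE (pairE natE natE)))) (fun p => affineBitRaw p.1 p.2)) :
    CodeFP GapCodes.cvpTupE (pairE (pairE natE (listE (listE (pairE natE (pairE natE (pairE natE natE))))))
      (pairE natE (listE (listE (pairE natE (pairE natE (pairE natE natE)))))))
      (fun c : CVPTup => latRedTup (((CVPTup.tl c).length, c.1.2), c.2)) := by
  have h0 := CodeFP.natEq.comp (ifp_hn.pair (CodeFP.const _ 0))
  have h1 := CodeFP.natEq.comp (ifp_hn.pair (CodeFP.const _ 1))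
  have hent : CodeFP GapCodes.cvpTupE intE (fun c : CVPTup => CVPTup.entry (((CVPTup.tl c).length, c.1.2), c.2) 0 0) :=
    (ifp_hentry.comp ((CodeFP.id _).pair (CodeFP.const _ ((0 : ℕ), (0 : ℕ))))).congr fun _ => rfl
  have htgt : CodeFP GapCodes.cvpTupE intE (fun c : CVPTup => CVPTup.tgt (((CVPTup.tl c).length, c.1.2), c.2) 0) :=
    (ifp_htgt.comp ((CodeFP.id _).pair (CodeFP.const _ (0 : ℕ)))).congr fun _ => rfl
  have hfar := ifp_oneDimFar.comp (hent.pair (htgt.pair (ifp_hnum.pair ifp_hden)))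
  exact (h0.ite (CodeFP.const _ noI) (h1.ite (hfar.ite (CodeFP.const _ yesI) (CodeFP.const _ noI))
    (ifp_hgeneric hA))).congr fun c => by simp only [latRedTup, decide_eq_true_eq]

/-- **Stub `stub_instanceFP` (W8): the guarded instance map `latRedG` is typed polynomial time** from
the `cvpTupE` code of `GapCVP` instances to the tuple code of `PEDBP` instances, given the
carry-automaton tabulator `hA`: the guard `|flat| = n², |tl| = n` is tested on codes, under it the
normalised tuple `ĉ` IS `c`, off it the image is the fixed NO-instance.
[cite: DvirGutfreundRothblumVadhan2010, §4.4; AroraBarak2009, §1.3] -/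
theorem stub_instanceFP (hA : CodeFP (pairE (rawE intE) unE) (rawE (pairE natE (pairE natE (pairE natE natE)))) (fun p => affineBitRaw p.1 p.2)) : CodeFP GapCodes.cvpTupE (pairE (pairE natE (listE (listE (pairE natE (pairE natE (pairE natE natE)))))) (pairE natE (listE (listE (pairE natE (pairE natE (pairE natE natE))))))) latRedG := by
  have hguard : CodeFP GapCodes.cvpTupE bitE (fun c : CVPTup =>
      decide ((CVPTup.flat c).length = CVPTup.n c * CVPTup.n c) && decide ((CVPTup.tl c).length = CVPTup.n c)) :=
    (CodeFP.natEq.comp (((CodeFP.natLength intE).comp ifp_flat).pair (CodeFP.natMul.comp (ifp_n.pair ifp_n)))).and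
      (CodeFP.natEq.comp (((CodeFP.natLength intE).comp ifp_tl).pair ifp_n))
  refine (hguard.ite (ifp_latRedTupNorm hA) (CodeFP.const _ noI)).congr fun c => ?_
  simp only [Bool.and_eq_true, decide_eq_true_eq, latRedG]
  by_cases h : (CVPTup.flat c).length = CVPTup.n c * CVPTup.n c ∧ (CVPTup.tl c).length = CVPTup.n c
  · have hc : (((CVPTup.tl c).length, c.1.2), c.2) = c := by rw [h.2]; rfl
    rw [if_pos h, if_pos h, hc]
  · rw [if_neg h, if_neg h]

end Summit.PneNP.PneNP.Cruxes.PeaThreeNotInP.LatticeLine
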